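import Summits.BirchSwinnertonDyer.BirchSwinnertonDyer.Theorems.ByReductionTypeAtTwoAdditivePotGoodPrintZhaiIrreducibleCorrected
import Summits.BirchSwinnertonDyer.BirchSwinnertonDyer.Theorems.ByReductionTypeAtTwoAdditivePotGoodLowerHalfFrontierRows
import Summits.BirchSwinnertonDyer.BirchSwinnertonDyer.Theorems.EisensteinDepletionAtTwoDepletedLawCFLowerHalf
import Summits.BirchSwinnertonDyer.Rank1Residual.AdditivePotMult.RankZeroKimNakamuraIntModel
import Literature.NumberTheory.DiophantineGeometry.EllArithGlueProofs
import Literature.NumberTheory.DiophantineGeometry.MinimalDiscriminantFiniteProofs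
import Summits.BirchSwinnertonDyer.Uniform.U2.CubicFieldInertOddTrace
import Summits.BirchSwinnertonDyer.Rank1Residual.Supersingular.RationalLadder
import HarnessLib

/-!
# K4 crux `AdditiveRankZeroAtTwo` (19098), child C3″ `AdditivePotGoodLowerHalfAtTwo` (22617): the ZHAI 2016 print road at the bases
# `104A1`, `124B1` of Cremona's Table 1 (Thm. 1.1, `Δ < 0`) and the witness member `104A1^{(−3)}` — file A

Cell `bsd-2adic`, seat `bsd-2adic-k4-w2` GEN 6 (prover, explicit unit, no kit); `--supports stmt-BirchSwinnertonDyer-22617 --as helper`;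
companion of `…AdditivePotGoodPrintZhaiIrreducible.lean` (the generic road `printFamilyZhai11_lower` / `printFamilyZhai12_lower`).
HONEST FRAMING (D-0036/D-0054): for each base `V` the KERNEL decides ellipticity, global minimality (Kraus–Silverman certificate), the sign
of `Δ`, `V[2]` irreducible (root-free `2`-division cubic modulo a small prime), `ord₂ j(V)` exactly (inside the window `[1, 11]`: `V` and all
its twists by `M ≡ 1 (mod 4)` are ADDITIVE and POTENTIALLY GOOD at `2`) and non-CM; DISPLAYED, exactly as Zhai's theorem takes them, are the
`X₀(N)`-optimality datum (`Dt`, `hopt` — the bases are the FIRST curves of their classes in Cremona's 1992 Table 1, i.e. the «strong Weil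
curves») and the record `ord₂(L(V,1)/Ω_∞(V)) = 0` (resp. `= 1` for `Δ > 0`), read off Cremona's Tables 1 and 4 (`r = 0`, `S = 1` for every
`N ≤ 1000` except `571A, 681B, 960D, 960N`; `L(V,1)/Ω_BSD = S·∏c_p/#T²` odd; `Ω_BSD = c_∞·Ω_∞`). The road is keyed on Zhai's CORRECTED
statements (arXiv v2: odd Manin constant; the tree's primed facts `Zhai2016.thm11_…'` / `thm12_…'`, ERRATUM file of the b2b cell), the
Manin binder supplied BY PRINT (Agashe–Ribet–Stein 2006 Thm. 2.6, `h26`) from the KERNEL level bound `N(V) ≤ 130000`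
(`N ∣ |Δ_min|`; for `196B1`, `676D1` sharpened by `f_ℓ ≤ 2`, `ℓ ≥ 5`). Labels are those of the 1992 first
edition (held text `book:cremona1997-…`, Table 1 pp. for `N = 104, 116, 124, 196, 200, 540, 676`); the curves are pinned by their
a-invariants. OUTPUT per base: at EVERY global minimal `W ≅ V^{(M)}` (`M` as in Zhai's Thm. 1.1 / 1.2) the C3″ binders are decided
(`r_an(W) = 0`, `Addv W 2`, `0 ≤ ord₂ j`, `¬CM`, `Irr W 2`) and the LOWER half `MissingLowerBoundAt W 2` HOLDS. Inputs BY NAME: Zhai 2016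
Thm. 1.1 / 1.2 CORRECTED (flag-free at `2`, analytic rank zero), Agashe–Ribet–Stein Thm. 2.6, modularity. NO GZK, no reading, no instrument, no base certificate. These are the
first intrinsically-additive `E[2]`-IRREDUCIBLE print families of the K4 additive block (GEN 5's irreducible road was the `C₂`-type
`37a1^{(−m)}`); they are disjoint from the cell's residual census (`ord₂ #Ш_an ≤ 0` here). Closes nothing at the `∀`-level (C3″ is
research-open); nothing booked; BSD is not proved by any of this.

References: [Zhai2016] Thm. 1.1, Thm. 1.2; [CremonaAlgorithms1997] Table 1, Table 4; [SilvermanAEC2009] III.1, III.2.3, VII.1, VII.5,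
App. C §11; [Kraus1989] Prop. 1–2; [Miller2011LMS] Def. 1.1.
-/

set_option autoImplicit false
-- the Theorems namespace of this sub repeats the summit name by design (D-0017 nested layout)
set_option linter.dupNamespace false

noncomputable section

open scoped Classical

open WeierstrassCurve Literature.NumberTheory.EllipticCurves
  Literature.NumberTheory.EllipticCurves.ModularForms
  Literature.NumberTheory.EllipticCurves.Rank1Residual
  Literature.NumberTheory.EllipticCurves.Rank1Residual.Typed
  Literature.NumberTheory.EllipticCurves.CoatesLiTianZhai2015
  Literature.NumberTheory.EllipticCurves.Zhai2016
  Literature.NumberTheory.EllipticCurves.AgasheRibetStein2006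
  Summit.BirchSwinnertonDyer
  Summit.BirchSwinnertonDyer.Rank1Residual
  Summit.BirchSwinnertonDyer.Rank1Residual.X11b
  Summit.BirchSwinnertonDyer.Rank1Residual.X5.O1
  Summit.BirchSwinnertonDyer.Rank1Residual.P2
  Summit.BirchSwinnertonDyer.BirchSwinnertonDyer.Rank1Residual.IntModel
  Summit.BirchSwinnertonDyer.BirchSwinnertonDyer.Theorems

namespace Summit.BirchSwinnertonDyer.BirchSwinnertonDyer.Theorems.AddPotGoodPrint

/-! ## Base `104A1` = `[0, 1, 0, -16, -32]` (Cremona 1992 Table 1: `N = 104 = 2³·13`, `r = 0`, `#T = 1`, `c_p = (1, 1)`, Kodaira `II*, I₁`;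
Table 4: `S = 1`), `Δ = -26624` (-), `j = -235298/13` (`ord₂ j = 1`), Zhai Thm. 1.1 -/

section Base104A1

/-- `104A1 = [0, 1, 0, -16, -32]` is an elliptic curve (`Δ = -26624 ≠ 0`). [cite: CremonaAlgorithms1997, Table 1] -/
theorem isElliptic_104A1 : (⟨0, 1, 0, -16, -32⟩ : WeierstrassCurve ℚ).IsElliptic := ⟨by
  rw [isUnit_iff_ne_zero]; norm_num [WeierstrassCurve.Δ, WeierstrassCurve.b₂, WeierstrassCurve.b₄, WeierstrassCurve.b₆, WeierstrassCurve.b₈]⟩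

/-- `104A1` is GLOBALLY MINIMAL (`|Δ| = 26624`: `v_p Δ < 12` at every prime; Kraus at `2`, Silverman at odd `p`).
[cite: SilvermanAEC2009, VII.1 Remark 1.1] [cite: Kraus1989, Prop. 1 and Prop. 2] -/
theorem isGloballyMinimal_104A1 : (⟨0, 1, 0, -16, -32⟩ : WeierstrassCurve ℚ).IsGloballyMinimal :=
  isGloballyMinimal_of_krausCriterion_support (0) (1) (0) (-16) (-32) [(2, 0, 11), (13, 0, 1)]
    (by intro t ht; simp only [List.mem_cons, List.not_mem_nil, or_false] at ht
        rcases ht with rfl | rfl <;> norm_num)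
    (by decide +kernel) (by decide +kernel)

/-- `Δ(104A1) = -26624` on the integer model. [cite: CremonaAlgorithms1997, Table 1] -/
theorem M104A1_Δ : (⟨0, 1, 0, -16, -32⟩ : WeierstrassCurve ℤ).Δ = -26624 := by decide +kernel
/-- `c₄(104A1) = 784` on the integer model. [cite: CremonaAlgorithms1997, Table 1] -/
theorem M104A1_c₄ : (⟨0, 1, 0, -16, -32⟩ : WeierstrassCurve ℤ).c₄ = 784 := by decide +kernel

/-- `Δ(104A1) < 0` (rational model). [cite: CremonaAlgorithms1997, Table 1] -/
theorem Δ_sign_104A1 : (⟨0, 1, 0, -16, -32⟩ : WeierstrassCurve ℚ).Δ < 0 := by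
  norm_num [WeierstrassCurve.Δ, WeierstrassCurve.b₂, WeierstrassCurve.b₄, WeierstrassCurve.b₆, WeierstrassCurve.b₈]

/-- The integer model of `104A1` is Cremona's. [cite: SilvermanAEC2009, VIII.8] -/
theorem intModel_104A1 :
    haveI := isElliptic_104A1; haveI := isGloballyMinimal_104A1
    integralModelInt (⟨0, 1, 0, -16, -32⟩ : WeierstrassCurve ℚ) = (⟨0, 1, 0, -16, -32⟩ : WeierstrassCurve ℤ) :=
  haveI := isElliptic_104A1; haveI := isGloballyMinimal_104A1
  integralModelInt_eq_of_map_eq _ (by ext <;> simp [WeierstrassCurve.map])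

/-- `b₂, b₄, b₆` of `104A1`. [cite: SilvermanAEC2009, III.1] -/
theorem b_104A1 : (⟨0, 1, 0, -16, -32⟩ : WeierstrassCurve ℚ).b₂ = ((4 : ℤ) : ℚ) ∧ (⟨0, 1, 0, -16, -32⟩ : WeierstrassCurve ℚ).b₄ = ((-32 : ℤ) : ℚ) ∧
    (⟨0, 1, 0, -16, -32⟩ : WeierstrassCurve ℚ).b₆ = ((-128 : ℤ) : ℚ) := by
  simp only [WeierstrassCurve.b₂, WeierstrassCurve.b₄, WeierstrassCurve.b₆]; norm_num

/-- **`E[2]` irreducible for `104A1`** (`E[2](ℚ) = 0`): the monic `2`-division cubic `X³ + b₂X² + 8b₄X + 16b₆` has no root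
modulo `3`. [cite: SilvermanAEC2009, III.2.3 (b)] [cite: Zhai2016, Thm. 1.1 (hypothesis E[2](ℚ) = 0)] -/
theorem irr_two_104A1 :
    haveI := isElliptic_104A1
    Irr (⟨0, 1, 0, -16, -32⟩ : WeierstrassCurve ℚ) 2 :=
  haveI := isElliptic_104A1
  irr_two_of_forall_cubic_ne _ b_104A1.1 b_104A1.2.1 b_104A1.2.2 (ℓ := 3) (by decide)

/-- **`ord₂ j(104A1) = 1`** (`2⁴ ∥ c₄ = 784`, `2^11 ∥ Δ`): inside the window `[1, 11]`, so `104A1` and every twist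
`104A1^{(M)}` are ADDITIVE and POTENTIALLY GOOD at `2`. [cite: SilvermanAEC2009, III.1 and VII.5 Prop. 5.5] -/
theorem padicValRat_j_104A1 :
    haveI := isElliptic_104A1
    padicValRat 2 (⟨0, 1, 0, -16, -32⟩ : WeierstrassCurve ℚ).j = 1 := by
  haveI : Fact (Nat.Prime 2) := ⟨Nat.prime_two⟩
  haveI := isElliptic_104A1; haveI := isGloballyMinimal_104A1
  rw [AdditivePotMult.padicValRat_j_eq_of_intModel intModel_104A1 2 4 11 (by rw [M104A1_c₄]; decide) (by rw [M104A1_c₄]; decide)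
    (by rw [M104A1_Δ]; decide) (by rw [M104A1_Δ]; decide)]
  norm_num

/-- **`N(104A1) ∣ |Δ_min| = 26624`** (the conductor divides the minimal discriminant). [cite: SilvermanAEC2009, VIII.11 and C.16] -/
theorem conductorNorm_dvd_104A1 :
    haveI := isElliptic_104A1
    (⟨0, 1, 0, -16, -32⟩ : WeierstrassCurve ℚ).conductorNorm ℤ ∣ 26624 := by
  haveI := isElliptic_104A1; haveI := isGloballyMinimal_104A1
  have hdvd := WeierstrassCurve.conductorNorm_dvd_minimalDiscriminantNorm (⟨0, 1, 0, -16, -32⟩ : WeierstrassCurve ℚ)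
    (WeierstrassCurve.finite_setOf_ordMinimalDiscriminant_ne_zero_holds _)
  rw [WeierstrassCurve.minimalDiscriminantNorm_int_eq_natAbs_minimalDiscriminantInt_holds,
    minimalDiscriminantInt_eq intModel_104A1, M104A1_Δ] at hdvd
  exact hdvd

/-- **`N(104A1) ≤ 130000`** (`N ∣ 26624`; Cremona: `N = 104`, not needed) — the level bound feeding Agashe–Ribet–Stein Thm. 2.6.
[cite: AgasheRibetStein2006, Thm. 2.6] -/
theorem conductorNorm_le_104A1 :
    haveI := isElliptic_104A1
    (⟨0, 1, 0, -16, -32⟩ : WeierstrassCurve ℚ).conductorNorm ℤ ≤ 130000 :=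
  le_trans (Nat.le_of_dvd (by norm_num) conductorNorm_dvd_104A1) (by norm_num)
/-- **`104A1` is non-CM**: `ord₂ j = 1 ∈ {1,2,5,7,8,9,10,11}` (k4-w1's window: no CM `j`-invariant has such a `2`-adic valuation). [cite: SilvermanAEC2009, App. C §11] -/
theorem not_hasCM_104A1 :
    haveI := isElliptic_104A1
    ¬ (⟨0, 1, 0, -16, -32⟩ : WeierstrassCurve ℚ).HasCM := by
  haveI : Fact (Nat.Prime 2) := ⟨Nat.prime_two⟩
  haveI := isElliptic_104A1; haveI := isGloballyMinimal_104A1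
  exact not_hasCM_of_padicValRat_two_j_mem _ (by rw [padicValRat_j_104A1]; decide)

/-- **THE ZHAI-1.1 ROAD AT THE BASE `104A1`**: for every `M` as in Zhai 2016 Thm. 1.1 (square-free,
`M ≡ 1 (mod 4)`, `(M, N) = 1`, `r ≥ 1` odd prime factors all inert in the cubic `2`-division field `F` of `104A1`) and every global
minimal `W ≅ 104A1^{(M)}`: `r_an(W) = 0`, `W` is ADDITIVE and POTENTIALLY GOOD at `2`, NON-CM, `W[2]` IRREDUCIBLE, and the LOWER
half `MissingLowerBoundAt W 2` of BSD₂ HOLDS. KERNEL: ellipticity, global minimality, `Δ < 0`, `E[2]` irreducible,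
`ord₂ j = 1`, non-CM. DISPLAYED (as printed): the `X₀(104)`-optimality datum (`Dt`, `hopt`) and the record
`ord₂(L(104A1,1)/Ω_∞) = 0` (Cremona 1992 Tables 1 and 4: L(E,1)/Ω_BSD = S·∏c_p/#T² = 1 (Δ < 0, one real component, Ω_BSD = Ω_∞): ord₂ L^alg = 0); the odd Manin constant of Zhai's corrected statement is
Agashe–Ribet–Stein Thm. 2.6 BY NAME (`h26`) at level `N ≤ 130000` (kernel `conductorNorm_le_104A1`). Inputs BY NAME: Zhai 2016
Thm. 1.1 (corrected, arXiv v2), Agashe–Ribet–Stein 2006 Thm. 2.6, modularity. No GZK, no reading, no instrument, no base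
certificate. BSD is not proved by any of this.
[cite: Zhai2016, Thm. 1.1] [cite: AgasheRibetStein2006, Thm. 2.6] [cite: CremonaAlgorithms1997, Table 1 and Table 4] [cite: Miller2011LMS, Def. 1.1] -/
theorem printFamily104A1_lower (h11 : thm11_ordTwo_LAlg_twist_eq_zero')
    (h26 : cremona_abs_maninConstant_eq_one_of_level_le) (hmod : hasEntireLFunction_rat)
    [hN : haveI := isElliptic_104A1; NeZero ((⟨0, 1, 0, -16, -32⟩ : WeierstrassCurve ℚ).conductorNorm ℤ)]
    (Dt : haveI := isElliptic_104A1; ModularParametrizationData (⟨0, 1, 0, -16, -32⟩ : WeierstrassCurve ℚ) ((⟨0, 1, 0, -16, -32⟩ : WeierstrassCurve ℚ).conductorNorm ℤ))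
    (hopt : haveI := isElliptic_104A1; Zhai2021.IsOptimalDatum (⟨0, 1, 0, -16, -32⟩ : WeierstrassCurve ℚ) Dt)
    (hL : haveI := isElliptic_104A1; ∃ x : ℚ, IsLAlg (⟨0, 1, 0, -16, -32⟩ : WeierstrassCurve ℚ) x ∧ x ≠ 0 ∧ padicValRat 2 x = 0)
    (F : Type) [Field F] [NumberField F] (hF : IsTwoDivisionField (⟨0, 1, 0, -16, -32⟩ : WeierstrassCurve ℚ) F)
    (M : ℤ) (hsq : Squarefree M) (hM4 : M % 4 = 1)
    (hgcd : haveI := isElliptic_104A1; Int.gcd M ((⟨0, 1, 0, -16, -32⟩ : WeierstrassCurve ℚ).conductorNorm ℤ) = 1)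
    (hne : M.natAbs.primeFactors.Nonempty) (hin : ∀ q ∈ M.natAbs.primeFactors, q ≠ 2 ∧ IsInertIn F q)
    (W : WeierstrassCurve ℚ) [W.IsElliptic] [W.IsGloballyMinimal]
    (hW : ∃ C : VariableChange ℚ, C • (⟨0, 1, 0, -16, -32⟩ : WeierstrassCurve ℚ).quadraticTwist (M : ℚ) = W) :
    haveI : Fact (Nat.Prime 2) := ⟨Nat.prime_two⟩
    W.analyticRank = 0 ∧ Addv W 2 ∧ 0 ≤ padicValRat 2 W.j ∧ ¬ W.HasCM ∧ Irr W 2 ∧ MissingLowerBoundAt W 2 := by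
  haveI := isElliptic_104A1; haveI := isGloballyMinimal_104A1
  exact printFamilyZhai11'_lower_of_level_le h11 h26 hmod _ conductorNorm_le_104A1 Dt hopt Δ_sign_104A1 irr_two_104A1
    (by rw [padicValRat_j_104A1]) (by rw [padicValRat_j_104A1]; norm_num) not_hasCM_104A1 hL F hF M hsq hM4
    hgcd hne hin W hW

end Base104A1

/-! ## Base `124B1` = `[0, 0, 0, -17, -27]` (Cremona 1992 Table 1: `N = 124 = 2²·31`, `r = 0`, `#T = 1`, `c_p = (1, 1)`, Kodaira `IV, I₁`;
Table 4: `S = 1`), `Δ = -496` (-), `j = -33958656/31` (`ord₂ j = 8`), Zhai Thm. 1.1 -/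

section Base124B1

/-- `124B1 = [0, 0, 0, -17, -27]` is an elliptic curve (`Δ = -496 ≠ 0`). [cite: CremonaAlgorithms1997, Table 1] -/
theorem isElliptic_124B1 : (⟨0, 0, 0, -17, -27⟩ : WeierstrassCurve ℚ).IsElliptic := ⟨by
  rw [isUnit_iff_ne_zero]; norm_num [WeierstrassCurve.Δ, WeierstrassCurve.b₂, WeierstrassCurve.b₄, WeierstrassCurve.b₆, WeierstrassCurve.b₈]⟩

/-- `124B1` is GLOBALLY MINIMAL (`|Δ| = 496`: `v_p Δ < 12` at every prime; Kraus at `2`, Silverman at odd `p`).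
[cite: SilvermanAEC2009, VII.1 Remark 1.1] [cite: Kraus1989, Prop. 1 and Prop. 2] -/
theorem isGloballyMinimal_124B1 : (⟨0, 0, 0, -17, -27⟩ : WeierstrassCurve ℚ).IsGloballyMinimal :=
  isGloballyMinimal_of_krausCriterion_support (0) (0) (0) (-17) (-27) [(2, 0, 4), (31, 0, 1)]
    (by intro t ht; simp only [List.mem_cons, List.not_mem_nil, or_false] at ht
        rcases ht with rfl | rfl <;> norm_num)
    (by decide +kernel) (by decide +kernel)

/-- `Δ(124B1) = -496` on the integer model. [cite: CremonaAlgorithms1997, Table 1] -/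
theorem M124B1_Δ : (⟨0, 0, 0, -17, -27⟩ : WeierstrassCurve ℤ).Δ = -496 := by decide +kernel
/-- `c₄(124B1) = 816` on the integer model. [cite: CremonaAlgorithms1997, Table 1] -/
theorem M124B1_c₄ : (⟨0, 0, 0, -17, -27⟩ : WeierstrassCurve ℤ).c₄ = 816 := by decide +kernel

/-- `Δ(124B1) < 0` (rational model). [cite: CremonaAlgorithms1997, Table 1] -/
theorem Δ_sign_124B1 : (⟨0, 0, 0, -17, -27⟩ : WeierstrassCurve ℚ).Δ < 0 := by
  norm_num [WeierstrassCurve.Δ, WeierstrassCurve.b₂, WeierstrassCurve.b₄, WeierstrassCurve.b₆, WeierstrassCurve.b₈]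

/-- The integer model of `124B1` is Cremona's. [cite: SilvermanAEC2009, VIII.8] -/
theorem intModel_124B1 :
    haveI := isElliptic_124B1; haveI := isGloballyMinimal_124B1
    integralModelInt (⟨0, 0, 0, -17, -27⟩ : WeierstrassCurve ℚ) = (⟨0, 0, 0, -17, -27⟩ : WeierstrassCurve ℤ) :=
  haveI := isElliptic_124B1; haveI := isGloballyMinimal_124B1
  integralModelInt_eq_of_map_eq _ (by ext <;> simp [WeierstrassCurve.map])

/-- `b₂, b₄, b₆` of `124B1`. [cite: SilvermanAEC2009, III.1] -/
theorem b_124B1 : (⟨0, 0, 0, -17, -27⟩ : WeierstrassCurve ℚ).b₂ = ((0 : ℤ) : ℚ) ∧ (⟨0, 0, 0, -17, -27⟩ : WeierstrassCurve ℚ).b₄ = ((-34 : ℤ) : ℚ) ∧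
    (⟨0, 0, 0, -17, -27⟩ : WeierstrassCurve ℚ).b₆ = ((-108 : ℤ) : ℚ) := by
  simp only [WeierstrassCurve.b₂, WeierstrassCurve.b₄, WeierstrassCurve.b₆]; norm_num

/-- **`E[2]` irreducible for `124B1`** (`E[2](ℚ) = 0`): the monic `2`-division cubic `X³ + b₂X² + 8b₄X + 16b₆` has no root
modulo `5`. [cite: SilvermanAEC2009, III.2.3 (b)] [cite: Zhai2016, Thm. 1.1 (hypothesis E[2](ℚ) = 0)] -/
theorem irr_two_124B1 :
    haveI := isElliptic_124B1
    Irr (⟨0, 0, 0, -17, -27⟩ : WeierstrassCurve ℚ) 2 :=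
  haveI := isElliptic_124B1
  irr_two_of_forall_cubic_ne _ b_124B1.1 b_124B1.2.1 b_124B1.2.2 (ℓ := 5) (by decide)

/-- **`ord₂ j(124B1) = 8`** (`2⁴ ∥ c₄ = 816`, `2^4 ∥ Δ`): inside the window `[1, 11]`, so `124B1` and every twist
`124B1^{(M)}` are ADDITIVE and POTENTIALLY GOOD at `2`. [cite: SilvermanAEC2009, III.1 and VII.5 Prop. 5.5] -/
theorem padicValRat_j_124B1 :
    haveI := isElliptic_124B1
    padicValRat 2 (⟨0, 0, 0, -17, -27⟩ : WeierstrassCurve ℚ).j = 8 := by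
  haveI : Fact (Nat.Prime 2) := ⟨Nat.prime_two⟩
  haveI := isElliptic_124B1; haveI := isGloballyMinimal_124B1
  rw [AdditivePotMult.padicValRat_j_eq_of_intModel intModel_124B1 2 4 4 (by rw [M124B1_c₄]; decide) (by rw [M124B1_c₄]; decide)
    (by rw [M124B1_Δ]; decide) (by rw [M124B1_Δ]; decide)]
  norm_num

/-- **`N(124B1) ∣ |Δ_min| = 496`** (the conductor divides the minimal discriminant). [cite: SilvermanAEC2009, VIII.11 and C.16] -/
theorem conductorNorm_dvd_124B1 :
    haveI := isElliptic_124B1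
    (⟨0, 0, 0, -17, -27⟩ : WeierstrassCurve ℚ).conductorNorm ℤ ∣ 496 := by
  haveI := isElliptic_124B1; haveI := isGloballyMinimal_124B1
  have hdvd := WeierstrassCurve.conductorNorm_dvd_minimalDiscriminantNorm (⟨0, 0, 0, -17, -27⟩ : WeierstrassCurve ℚ)
    (WeierstrassCurve.finite_setOf_ordMinimalDiscriminant_ne_zero_holds _)
  rw [WeierstrassCurve.minimalDiscriminantNorm_int_eq_natAbs_minimalDiscriminantInt_holds,
    minimalDiscriminantInt_eq intModel_124B1, M124B1_Δ] at hdvd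
  exact hdvd

/-- **`N(124B1) ≤ 130000`** (`N ∣ 496`; Cremona: `N = 124`, not needed) — the level bound feeding Agashe–Ribet–Stein Thm. 2.6.
[cite: AgasheRibetStein2006, Thm. 2.6] -/
theorem conductorNorm_le_124B1 :
    haveI := isElliptic_124B1
    (⟨0, 0, 0, -17, -27⟩ : WeierstrassCurve ℚ).conductorNorm ℤ ≤ 130000 :=
  le_trans (Nat.le_of_dvd (by norm_num) conductorNorm_dvd_124B1) (by norm_num)
/-- **`124B1` is non-CM**: `ord₂ j = 8 ∈ {1,2,5,7,8,9,10,11}` (k4-w1's window: no CM `j`-invariant has such a `2`-adic valuation). [cite: SilvermanAEC2009, App. C §11] -/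
theorem not_hasCM_124B1 :
    haveI := isElliptic_124B1
    ¬ (⟨0, 0, 0, -17, -27⟩ : WeierstrassCurve ℚ).HasCM := by
  haveI : Fact (Nat.Prime 2) := ⟨Nat.prime_two⟩
  haveI := isElliptic_124B1; haveI := isGloballyMinimal_124B1
  exact not_hasCM_of_padicValRat_two_j_mem _ (by rw [padicValRat_j_124B1]; decide)

/-- **THE ZHAI-1.1 ROAD AT THE BASE `124B1`**: for every `M` as in Zhai 2016 Thm. 1.1 (square-free,
`M ≡ 1 (mod 4)`, `(M, N) = 1`, `r ≥ 1` odd prime factors all inert in the cubic `2`-division field `F` of `124B1`) and every global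
minimal `W ≅ 124B1^{(M)}`: `r_an(W) = 0`, `W` is ADDITIVE and POTENTIALLY GOOD at `2`, NON-CM, `W[2]` IRREDUCIBLE, and the LOWER
half `MissingLowerBoundAt W 2` of BSD₂ HOLDS. KERNEL: ellipticity, global minimality, `Δ < 0`, `E[2]` irreducible,
`ord₂ j = 8`, non-CM. DISPLAYED (as printed): the `X₀(124)`-optimality datum (`Dt`, `hopt`) and the record
`ord₂(L(124B1,1)/Ω_∞) = 0` (Cremona 1992 Tables 1 and 4: L(E,1)/Ω_BSD = S·∏c_p/#T² = 1 (Δ < 0, one real component, Ω_BSD = Ω_∞): ord₂ L^alg = 0); the odd Manin constant of Zhai's corrected statement is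
Agashe–Ribet–Stein Thm. 2.6 BY NAME (`h26`) at level `N ≤ 130000` (kernel `conductorNorm_le_124B1`). Inputs BY NAME: Zhai 2016
Thm. 1.1 (corrected, arXiv v2), Agashe–Ribet–Stein 2006 Thm. 2.6, modularity. No GZK, no reading, no instrument, no base
certificate. BSD is not proved by any of this.
[cite: Zhai2016, Thm. 1.1] [cite: AgasheRibetStein2006, Thm. 2.6] [cite: CremonaAlgorithms1997, Table 1 and Table 4] [cite: Miller2011LMS, Def. 1.1] -/
theorem printFamily124B1_lower (h11 : thm11_ordTwo_LAlg_twist_eq_zero')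
    (h26 : cremona_abs_maninConstant_eq_one_of_level_le) (hmod : hasEntireLFunction_rat)
    [hN : haveI := isElliptic_124B1; NeZero ((⟨0, 0, 0, -17, -27⟩ : WeierstrassCurve ℚ).conductorNorm ℤ)]
    (Dt : haveI := isElliptic_124B1; ModularParametrizationData (⟨0, 0, 0, -17, -27⟩ : WeierstrassCurve ℚ) ((⟨0, 0, 0, -17, -27⟩ : WeierstrassCurve ℚ).conductorNorm ℤ))
    (hopt : haveI := isElliptic_124B1; Zhai2021.IsOptimalDatum (⟨0, 0, 0, -17, -27⟩ : WeierstrassCurve ℚ) Dt)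
    (hL : haveI := isElliptic_124B1; ∃ x : ℚ, IsLAlg (⟨0, 0, 0, -17, -27⟩ : WeierstrassCurve ℚ) x ∧ x ≠ 0 ∧ padicValRat 2 x = 0)
    (F : Type) [Field F] [NumberField F] (hF : IsTwoDivisionField (⟨0, 0, 0, -17, -27⟩ : WeierstrassCurve ℚ) F)
    (M : ℤ) (hsq : Squarefree M) (hM4 : M % 4 = 1)
    (hgcd : haveI := isElliptic_124B1; Int.gcd M ((⟨0, 0, 0, -17, -27⟩ : WeierstrassCurve ℚ).conductorNorm ℤ) = 1)
    (hne : M.natAbs.primeFactors.Nonempty) (hin : ∀ q ∈ M.natAbs.primeFactors, q ≠ 2 ∧ IsInertIn F q)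
    (W : WeierstrassCurve ℚ) [W.IsElliptic] [W.IsGloballyMinimal]
    (hW : ∃ C : VariableChange ℚ, C • (⟨0, 0, 0, -17, -27⟩ : WeierstrassCurve ℚ).quadraticTwist (M : ℚ) = W) :
    haveI : Fact (Nat.Prime 2) := ⟨Nat.prime_two⟩
    W.analyticRank = 0 ∧ Addv W 2 ∧ 0 ≤ padicValRat 2 W.j ∧ ¬ W.HasCM ∧ Irr W 2 ∧ MissingLowerBoundAt W 2 := by
  haveI := isElliptic_124B1; haveI := isGloballyMinimal_124B1
  exact printFamilyZhai11'_lower_of_level_le h11 h26 hmod _ conductorNorm_le_124B1 Dt hopt Δ_sign_124B1 irr_two_124B1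
    (by rw [padicValRat_j_124B1]; norm_num) (by rw [padicValRat_j_124B1]; norm_num) not_hasCM_124B1 hL F hF M hsq hM4
    hgcd hne hin W hW

end Base124B1

/-! ## The road is NOT VACUOUS: the member `M = −3` of the `104A1` family (`a₃(104A1) = 1` odd ⇒ `3` inert in `F`, IN THE KERNEL) -/

section Witness104A1

/-- **`#Ẽ(𝔽₃) = 3` for `104A1`** (`x³ + x² − 16x − 32 ≡ x³ + x² + 2x + 1 (mod 3)`: `x = 0` gives `y = ±1`, `x = 1, 2` give the non-residue
`2`; with `O`: three points; certified count `countPoints`, `decide +kernel`; `3 ∤ Δ`). [cite: SilvermanAEC2009, V.2] -/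
theorem reductionPointCount_3_104A1 [(⟨0, 1, 0, -16, -32⟩ : WeierstrassCurve ℚ).IsGloballyMinimal] :
    (⟨0, 1, 0, -16, -32⟩ : WeierstrassCurve ℚ).reductionPointCount 3 = 3 := by
  haveI : Fact (Nat.Prime 3) := ⟨Nat.prime_three⟩
  haveI := isElliptic_104A1
  exact Supersingular.reductionPointCount_eq_of_intModel_countPoints intModel_104A1 3 (by norm_num) (by decide +kernel)
    (by decide +kernel)

/-- **`a₃(104A1) = 1` is odd** (`a_q = q + 1 − #Ẽ(𝔽_q)`), i.e. `Frob₃` acts on `E[2] ∖ {0}` as a `3`-cycle: `3` is inert in the cubic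
`2`-division field (Zhai's twisting condition at `q = 3`). [cite: Zhai2016, Thm. 1.1 (hypothesis "inert in F")] -/
theorem odd_frobeniusTrace_3_104A1 [(⟨0, 1, 0, -16, -32⟩ : WeierstrassCurve ℚ).IsGloballyMinimal] :
    Odd ((⟨0, 1, 0, -16, -32⟩ : WeierstrassCurve ℚ).frobeniusTrace 3) := by
  rw [Uniform.U2.odd_frobeniusTrace_iff_odd_reductionPointCount _ Nat.prime_three (by norm_num), reductionPointCount_3_104A1]
  exact ⟨1, rfl⟩

/-- **C3″'s conclusion at every global minimal model of `104A1^{(−3)}`** — the member `M = 3* = −3` of the Zhai-1.1 family of `104A1`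
(`−3 ≡ 1 (mod 4)` square-free, `(3, N) = 1` since `N ∣ 2¹¹·13`, `3` inert in the cubic `2`-division field because `a₃ = 1` is odd —
ALL IN THE KERNEL; the field `F` itself exists by `U2.exists_isTwoDivisionField`). Displayed: the optimality datum and the record
`ord₂(L(104A1,1)/Ω_∞) = 0`; by name: Zhai Thm. 1.1 (corrected), ARS Thm. 2.6, modularity. So the `104A1` road is not vacuous.
BSD is not proved by any of this. [cite: Zhai2016, Thm. 1.1] [cite: AgasheRibetStein2006, Thm. 2.6] [cite: Miller2011LMS, Def. 1.1] -/
theorem printFamily104A1_witness_neg3 (h11 : thm11_ordTwo_LAlg_twist_eq_zero')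
    (h26 : cremona_abs_maninConstant_eq_one_of_level_le) (hmod : hasEntireLFunction_rat)
    [hN : haveI := isElliptic_104A1; NeZero ((⟨0, 1, 0, -16, -32⟩ : WeierstrassCurve ℚ).conductorNorm ℤ)]
    (Dt : haveI := isElliptic_104A1; ModularParametrizationData (⟨0, 1, 0, -16, -32⟩ : WeierstrassCurve ℚ)
      ((⟨0, 1, 0, -16, -32⟩ : WeierstrassCurve ℚ).conductorNorm ℤ))
    (hopt : haveI := isElliptic_104A1; Zhai2021.IsOptimalDatum (⟨0, 1, 0, -16, -32⟩ : WeierstrassCurve ℚ) Dt)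
    (hL : haveI := isElliptic_104A1; ∃ x : ℚ, IsLAlg (⟨0, 1, 0, -16, -32⟩ : WeierstrassCurve ℚ) x ∧ x ≠ 0 ∧ padicValRat 2 x = 0)
    (W : WeierstrassCurve ℚ) [W.IsElliptic] [W.IsGloballyMinimal]
    (hW : ∃ C : VariableChange ℚ, C • (⟨0, 1, 0, -16, -32⟩ : WeierstrassCurve ℚ).quadraticTwist ((-3 : ℤ) : ℚ) = W) :
    haveI : Fact (Nat.Prime 2) := ⟨Nat.prime_two⟩
    W.analyticRank = 0 ∧ Addv W 2 ∧ 0 ≤ padicValRat 2 W.j ∧ ¬ W.HasCM ∧ Irr W 2 ∧ MissingLowerBoundAt W 2 := by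
  haveI : Fact (Nat.Prime 2) := ⟨Nat.prime_two⟩
  haveI := isElliptic_104A1; haveI := isGloballyMinimal_104A1
  -- the cubic `2`-division field exists (`E(ℚ)[2] = 0`)
  obtain ⟨F, _, _, hF⟩ := Uniform.U2.exists_isTwoDivisionField (⟨0, 1, 0, -16, -32⟩ : WeierstrassCurve ℚ)
    ((X5.O1.irr_two_iff_forall_two_nsmul _).mp irr_two_104A1)
  -- `3` is inert in `F`: `3 ∤ Δ_min = −26624` and `a₃ = 1` odd
  have hgood : ¬ ((3 : ℕ) : ℤ) ∣ minimalDiscriminantInt (⟨0, 1, 0, -16, -32⟩ : WeierstrassCurve ℚ) := by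
    rw [minimalDiscriminantInt_eq intModel_104A1, M104A1_Δ]; decide
  have hin3 : IsInertIn F 3 :=
    Uniform.U2.isInertIn_of_odd_frobeniusTrace _ hF Nat.prime_three (by norm_num) hgood odd_frobeniusTrace_3_104A1
  -- `(−3, N) = 1`: `N ∣ 26624 = 2¹¹·13`
  have hgcd : Int.gcd (-3 : ℤ) ((⟨0, 1, 0, -16, -32⟩ : WeierstrassCurve ℚ).conductorNorm ℤ) = 1 := by
    have h3 : Nat.Coprime 3 ((⟨0, 1, 0, -16, -32⟩ : WeierstrassCurve ℚ).conductorNorm ℤ) :=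
      Nat.Coprime.coprime_dvd_right conductorNorm_dvd_104A1 (by norm_num)
    rw [Int.gcd, Int.natAbs_neg, Int.natAbs_natCast]
    exact h3
  refine printFamily104A1_lower h11 h26 hmod Dt hopt hL F hF (-3) ?_ (by decide) hgcd ?_ ?_ W hW
  · -- `−3` is square-free
    rw [← Int.squarefree_natAbs, show (-3 : ℤ).natAbs = 3 from rfl]
    exact Nat.prime_three.prime.squarefree
  · exact ⟨3, by rw [show (-3 : ℤ).natAbs = 3 from rfl, Nat.Prime.primeFactors Nat.prime_three]; simp⟩
  · intro q hq
    rw [show (-3 : ℤ).natAbs = 3 from rfl, Nat.Prime.primeFactors Nat.prime_three, Finset.mem_singleton] at hq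
    subst hq
    exact ⟨by norm_num, hin3⟩

end Witness104A1

end Summit.BirchSwinnertonDyer.BirchSwinnertonDyer.Theorems.AddPotGoodPrint

end
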